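import Literature.Probability.Process.BrownianBridgeToPoint3
import Literature.Probability.Process.BrownianModulus
import HarnessLib

/-!
# Small-ball estimates for the Brownian bridge in `ℝ³` and Lévy's modulus for its driving motion

Topic `Literature/Probability/Process`; everything here is PROVED (no named fact). Quantitative
input for the polarity of points for the Brownian bridge-to-a-point (`BrownianBridgeToPoint3Polar`,
support for `KelvinBridgeCovariance`, item `stmt-CriticalPhenomena-5033` of the route
`Summit.CriticalPhenomena.Ising3DConformalLimit.Theses.MoebiusRestrictionCurrents`), on the tree's
concrete model (`bm3` = last three coordinates of `brownianQuad` on `(WienerQuad, wienerQuad)`;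
`bridgePath t x y ω s = x + (s/t)(y − x) + (B_s − (s/t)B_t)`):

* `map_quadCoord_wienerQuad`, `ae_modulus_brownianQuad`, `ae_modulus_bm3` — each coordinate path
  of `wienerQuad` has the pre-Wiener law, so Lévy's modulus of continuity
  (`IsBrownianReal.ae_exists_dist_le`, file `BrownianModulus`) transfers: a.s. there is `C` with
  `dist (B_s, B_u) ≤ C √((n+1)2⁻ⁿ)` for all `n` and `s, u ≤ N` with `|s − u| ≤ 2⁻ⁿ`;
* `gaussianReal_Icc_le`, `gaussVec_box_le` — `N(m, v)` charges an interval by at most its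
  length over `√(2πv)`; `N(0, uI₄)` charges a box of half-width `w` in the last three coordinates
  by at most `(2w/√(2πu))³`;
* `measure_noiseBox_le` — **small-ball estimate for the bridge noise**: for `0 < u < t`,
  `c = u/t`, the vector `(1 − c)W_u − c(W_t − W_u)` (last three coordinates = `B_u − (u/t)B_t`)
  lies in a box of half-width `ρ` with probability `≤ (2ρ/((1 − c)√(2πu)))³` — the increment
  `W_t − W_u` is independent of `W_u` (weak Markov property of `IsBrownianVec`) and is integrated
  out (`IsBrownianVec.integral_comp_eq_integral_integral_of_indepFun`), leaving a Gaussian box;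
* `measure_dist_bridgePath_le` — hence `P(dist (X_u, z) ≤ ρ) ≤ (2ρ/((1 − u/t)√(2πu)))³` for the
  bridge `X` of duration `t` from `x` to `y` and any point `z`.

## References

* J.-F. Le Gall, *Brownian Motion, Martingales, and Stochastic Calculus*, GTM 274 (2016), Ch. 2
  (Gaussian marginals, simple Markov property, modulus of continuity). [Legall2016]
* P. Lévy, *Théorie de l'addition des variables aléatoires* (1937), §52 (modulus). [folklore]
-/

noncomputable section

open MeasureTheory ProbabilityTheory TopologicalSpace Set Metric Filter
open scoped NNReal ENNReal Topology Real

namespace Literature.Probability.Process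

namespace BrownianBridgeToPoint3

/-- The coordinate paths of `wienerQuad` have the pre-Wiener law. [folklore] -/
theorem map_quadCoord_wienerQuad (i : Fin 4) : wienerQuad.map (quadCoord i) = preWienerMeasure := by
  haveI := RandomPlanarGeometry.isProbabilityMeasure_preWienerMeasure'
  have h1 : wienerPair.map Prod.fst = preWienerMeasure := by
    rw [wienerPair, Measure.map_fst_prod, measure_univ, one_smul]
  have h2 : wienerPair.map Prod.snd = preWienerMeasure := by
    rw [wienerPair, Measure.map_snd_prod, measure_univ, one_smul]
  have hq1 : wienerQuad.map Prod.fst = wienerPair := by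
    rw [wienerQuad, Measure.map_fst_prod, measure_univ, one_smul]
  have hq2 : wienerQuad.map Prod.snd = wienerPair := by
    rw [wienerQuad, Measure.map_snd_prod, measure_univ, one_smul]
  fin_cases i
  · change wienerQuad.map (Prod.fst ∘ Prod.fst) = _
    rw [← Measure.map_map measurable_fst measurable_fst, hq1, h1]
  · change wienerQuad.map (Prod.snd ∘ Prod.fst) = _
    rw [← Measure.map_map measurable_snd measurable_fst, hq1, h2]
  · change wienerQuad.map (Prod.fst ∘ Prod.snd) = _
    rw [← Measure.map_map measurable_fst measurable_snd, hq2, h1]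
  · change wienerQuad.map (Prod.snd ∘ Prod.snd) = _
    rw [← Measure.map_map measurable_snd measurable_snd, hq2, h2]

/-- **Lévy's modulus for each coordinate of `brownianQuad`**: for every horizon `N`, almost
surely there is `C` with `|Wⁱ_s − Wⁱ_u| ≤ C √((n+1) 2⁻ⁿ)` for all `n` and `s, u ≤ N` with
`|s − u| ≤ 2⁻ⁿ` (transfer of `IsBrownianReal.ae_exists_dist_le` along the coordinate laws).
[folklore] -/
theorem ae_modulus_brownianQuad (i : Fin 4) (N : ℕ) :
    ∀ᵐ ω ∂wienerQuad, ∃ C : ℝ, ∀ (n : ℕ) (s u : ℝ≥0), s ≤ N → u ≤ N → dist s u ≤ (2 ^ n)⁻¹ →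
      dist (brownianQuad s ω i) (brownianQuad u ω i) ≤ C * Real.sqrt ((n + 1) / 2 ^ n) := by
  have h := RandomPlanarGeometry.isBrownianReal_brownian'.ae_exists_dist_le N
  rw [← map_quadCoord_wienerQuad i] at h
  exact ae_of_ae_map (measurable_quadCoord i).aemeasurable h

/-- Coordinates of `bm3` are the last three coordinates of `brownianQuad`. [folklore] -/
theorem bm3_apply (s : ℝ≥0) (ω : WienerQuad) (j : Fin 3) : bm3 s ω j = brownianQuad s ω j.succ := by
  simp [bm3]

/-- **Lévy's modulus for the three-dimensional Brownian motion `bm3`** (Euclidean distance; the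
constant absorbs the factor `√3 ≤ 2`). [folklore] -/
theorem ae_modulus_bm3 (N : ℕ) :
    ∀ᵐ ω ∂wienerQuad, ∃ C : ℝ, ∀ (n : ℕ) (s u : ℝ≥0), s ≤ N → u ≤ N → dist s u ≤ (2 ^ n)⁻¹ →
      dist (bm3 s ω) (bm3 u ω) ≤ C * Real.sqrt ((n + 1) / 2 ^ n) := by
  filter_upwards [ae_modulus_brownianQuad 1 N, ae_modulus_brownianQuad 2 N,
    ae_modulus_brownianQuad 3 N] with ω h1 h2 h3
  obtain ⟨C1, hC1⟩ := h1
  obtain ⟨C2, hC2⟩ := h2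
  obtain ⟨C3, hC3⟩ := h3
  refine ⟨2 * (|C1| + |C2| + |C3|), fun n s u hs hu hd => ?_⟩
  set q : ℝ := Real.sqrt ((n + 1) / 2 ^ n) with hq
  have hq0 : 0 ≤ q := Real.sqrt_nonneg _
  set M : ℝ := (|C1| + |C2| + |C3|) * q with hM
  have hM0 : 0 ≤ M := by positivity
  have hb : ∀ j : Fin 3, dist (bm3 s ω j) (bm3 u ω j) ≤ M := by
    intro j
    rw [bm3_apply, bm3_apply]
    fin_cases j
    · calc dist (brownianQuad s ω (1 : Fin 4)) (brownianQuad u ω 1) ≤ C1 * q := hC1 n s u hs hu hd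
        _ ≤ |C1| * q := mul_le_mul_of_nonneg_right (le_abs_self _) hq0
        _ ≤ M := by rw [hM]; nlinarith [abs_nonneg C2, abs_nonneg C3]
    · calc dist (brownianQuad s ω (2 : Fin 4)) (brownianQuad u ω 2) ≤ C2 * q := hC2 n s u hs hu hd
        _ ≤ |C2| * q := mul_le_mul_of_nonneg_right (le_abs_self _) hq0
        _ ≤ M := by rw [hM]; nlinarith [abs_nonneg C1, abs_nonneg C3]
    · calc dist (brownianQuad s ω (3 : Fin 4)) (brownianQuad u ω 3) ≤ C3 * q := hC3 n s u hs hu hd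
        _ ≤ |C3| * q := mul_le_mul_of_nonneg_right (le_abs_self _) hq0
        _ ≤ M := by rw [hM]; nlinarith [abs_nonneg C1, abs_nonneg C2]
  have hsum : ∑ j : Fin 3, dist (bm3 s ω j) (bm3 u ω j) ^ 2 ≤ (2 * M) ^ 2 := by
    rw [Fin.sum_univ_three]
    have h0 := hb 0
    have h1 := hb 1
    have h2 := hb 2
    nlinarith [dist_nonneg (x := bm3 s ω 0) (y := bm3 u ω 0),
      dist_nonneg (x := bm3 s ω 1) (y := bm3 u ω 1), dist_nonneg (x := bm3 s ω 2) (y := bm3 u ω 2)]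
  rw [EuclideanSpace.dist_eq, show 2 * (|C1| + |C2| + |C3|) * q = 2 * M by rw [hM]; ring]
  exact Real.sqrt_le_iff.2 ⟨by positivity, hsum⟩


/-! ### Small-ball bounds: Gaussian boxes and the bridge marginal -/

/-- A one-dimensional Gaussian charges an interval by at most its length over `√(2πv)`.
[folklore] -/
theorem gaussianReal_Icc_le (m : ℝ) {v : ℝ≥0} (hv : v ≠ 0) (l r : ℝ) :
    gaussianReal m v (Icc l r) ≤ ENNReal.ofReal ((r - l) / Real.sqrt (2 * π * v)) := by
  rw [gaussianReal_apply m hv]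
  have hv' : (0 : ℝ) < v := by exact_mod_cast pos_iff_ne_zero.2 hv
  calc ∫⁻ x in Icc l r, gaussianPDF m v x
      ≤ ∫⁻ _ in Icc l r, ENNReal.ofReal ((Real.sqrt (2 * π * v))⁻¹) := by
        refine lintegral_mono fun x => ?_
        rw [gaussianPDF, gaussianPDFReal]
        refine ENNReal.ofReal_le_ofReal ?_
        have h1 : Real.exp (-(x - m) ^ 2 / (2 * v)) ≤ 1 := Real.exp_le_one_iff.2
          (div_nonpos_of_nonpos_of_nonneg (neg_nonpos.2 (sq_nonneg _)) (by positivity))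
        calc (Real.sqrt (2 * π * v))⁻¹ * Real.exp (-(x - m) ^ 2 / (2 * v))
            ≤ (Real.sqrt (2 * π * v))⁻¹ * 1 := mul_le_mul_of_nonneg_left h1 (by positivity)
          _ = _ := mul_one _
    _ = ENNReal.ofReal ((Real.sqrt (2 * π * v))⁻¹) * volume (Icc l r) := setLIntegral_const _ _
    _ = ENNReal.ofReal ((r - l) / Real.sqrt (2 * π * v)) := by
        rw [Real.volume_Icc, ← ENNReal.ofReal_mul (by positivity), div_eq_inv_mul]

/-- **A centred Gaussian vector `N(0, u I₄)` charges a box of half-width `w` in the last three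
coordinates by at most `(2w/√(2πu))³`.** [folklore] -/
theorem gaussVec_box_le {u : ℝ≥0} (hu : u ≠ 0) (c : Fin 4 → ℝ) {w : ℝ} (hw : 0 ≤ w) :
    gaussVec 4 u {b | ∀ i : Fin 4, i ≠ 0 → |b i - c i| ≤ w}
      ≤ ENNReal.ofReal ((2 * w / Real.sqrt (2 * π * u)) ^ 3) := by
  classical
  set s : Fin 4 → Set ℝ := fun i => if i = 0 then univ else Icc (c i - w) (c i + w) with hs
  have hset : {b : Fin 4 → ℝ | ∀ i : Fin 4, i ≠ 0 → |b i - c i| ≤ w} = Set.pi univ s := by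
    ext b
    simp only [mem_setOf_eq, mem_univ_pi, hs]
    constructor
    · intro h i
      by_cases hi : i = 0
      · simp [hi]
      · rw [if_neg hi, mem_Icc]
        have := h i hi
        constructor <;> linarith [(abs_sub_le_iff.1 this).1, (abs_sub_le_iff.1 this).2]
    · intro h i hi
      have := h i
      rw [if_neg hi, mem_Icc] at this
      rw [abs_sub_le_iff]
      constructor <;> linarith [this.1, this.2]
  have hI : ∀ i : Fin 4, i ≠ 0 →
      gaussianReal 0 u (s i) ≤ ENNReal.ofReal (2 * w / Real.sqrt (2 * π * u)) := by
    intro i hi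
    rw [hs]
    simp only [if_neg hi]
    refine (gaussianReal_Icc_le 0 hu _ _).trans (le_of_eq ?_)
    congr 1
    ring
  rw [hset, gaussVec, Measure.pi_pi, Fin.prod_univ_four]
  have h0 : gaussianReal 0 u (s 0) = 1 := by
    rw [hs]
    simp
  rw [h0, one_mul, ENNReal.ofReal_pow (by positivity), pow_three']
  exact mul_le_mul' (mul_le_mul' (hI 1 (by decide)) (hI 2 (by decide))) (hI 3 (by decide))

/-- The test set of the small-ball estimate: pairs `(e, b)` (increment, position) whose
combination `(1 − c) b − c e` lies in the box of half-width `ρ` around `a` in the last three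
coordinates. [folklore] -/
def noiseBox (c : ℝ) (a : Fin 4 → ℝ) (ρ : ℝ) : Set ((Fin 4 → ℝ) × (Fin 4 → ℝ)) :=
  {p | ∀ i : Fin 4, i ≠ 0 → |((1 - c) * p.2 i - c * p.1 i) - a i| ≤ ρ}

/-- The test set is closed, hence measurable. [folklore] -/
theorem measurableSet_noiseBox (c : ℝ) (a : Fin 4 → ℝ) (ρ : ℝ) :
    MeasurableSet (noiseBox c a ρ) := by
  have h : noiseBox c a ρ = ⋂ i ∈ ({1, 2, 3} : Finset (Fin 4)),
      {p : (Fin 4 → ℝ) × (Fin 4 → ℝ) | |((1 - c) * p.2 i - c * p.1 i) - a i| ≤ ρ} := by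
    ext p
    simp only [noiseBox, mem_setOf_eq, mem_iInter, Finset.mem_insert, Finset.mem_singleton]
    constructor
    · rintro h i (rfl | rfl | rfl) <;> exact h _ (by decide)
    · intro h i hi
      fin_cases i
      · exact absurd rfl hi
      · exact h 1 (Or.inl rfl)
      · exact h 2 (Or.inr (Or.inl rfl))
      · exact h 3 (Or.inr (Or.inr rfl))
  rw [h]
  refine MeasurableSet.biInter (Set.to_countable _) fun i _ => ?_
  refine (isClosed_le ?_ continuous_const).measurableSet
  fun_prop

/-- Sections of the test set are Gaussian boxes of half-width `ρ/(1−c)`. [folklore] -/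
theorem noiseBox_section {c : ℝ} (hc : c < 1) (a e : Fin 4 → ℝ) (ρ : ℝ) :
    {b : Fin 4 → ℝ | (e, b) ∈ noiseBox c a ρ}
      = {b | ∀ i : Fin 4, i ≠ 0 → |b i - (a i + c * e i) / (1 - c)| ≤ ρ / (1 - c)} := by
  have h1c : 0 < 1 - c := by linarith
  ext b
  simp only [noiseBox, mem_setOf_eq]
  refine forall_congr' fun i => imp_congr_right fun _ => ?_
  rw [show b i - (a i + c * e i) / (1 - c) = ((1 - c) * b i - c * e i - a i) / (1 - c) by
    field_simp; ring, abs_div, abs_of_pos h1c, div_le_div_iff_of_pos_right h1c]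

/-- **Small-ball estimate for the bridge noise.** For `0 < u < t` and the four-dimensional
Brownian motion `W = brownianQuad`: with `c = u/t`, the vector `(1 − c) W_u − c (W_t − W_u)` (whose
last three coordinates are the noise `B_u − (u/t) B_t` of the bridge of duration `t` at time `u`)
lies in a box of half-width `ρ` in the last three coordinates with probability at most
`(2ρ/((1 − c)√(2πu)))³` — integrate out the independent increment `W_t − W_u` (weak Markov
property) and bound the Gaussian `N(0, uI)` box probability. [folklore] -/
theorem measure_noiseBox_le {u t : ℝ≥0} (hu : u ≠ 0) (hut : u < t) (a : Fin 4 → ℝ) {ρ : ℝ}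
    (hρ : 0 ≤ ρ) :
    wienerQuad {ω | (brownianQuad t ω - brownianQuad u ω, brownianQuad u ω)
        ∈ noiseBox ((u : ℝ) / t) a ρ}
      ≤ ENNReal.ofReal ((2 * (ρ / (1 - (u : ℝ) / t)) / Real.sqrt (2 * π * u)) ^ 3) := by
  have hW := isBrownianVec_brownianQuad
  set c : ℝ := (u : ℝ) / t with hc
  have ht0 : (0 : ℝ) < t := by exact_mod_cast lt_of_le_of_lt bot_le hut
  have hc1 : c < 1 := by
    rw [hc, div_lt_one ht0]
    exact_mod_cast hut
  have h1c : 0 < 1 - c := by linarith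
  set Bd : ℝ := (2 * (ρ / (1 - c)) / Real.sqrt (2 * π * u)) ^ 3 with hBd
  have hBd0 : 0 ≤ Bd := by positivity
  -- the two independent variables
  set U : WienerQuad → (Fin 4 → ℝ) := brownianQuad u with hUdef
  set ξ : WienerQuad → (Fin 4 → ℝ) := fun ω => brownianQuad t ω - brownianQuad u ω with hξdef
  have hUm : Measurable U := hW.measurable u
  have hξm : Measurable ξ := (hW.measurable t).sub (hW.measurable u)
  have hind : IndepFun ξ U wienerQuad := by
    have h0 := hW.indep_shift u
    have hξ' : ξ = (fun p : ℝ≥0 → (Fin 4 → ℝ) => p (t - u)) ∘ vecShift brownianQuad u := by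
      funext ω
      simp only [hξdef, Function.comp_apply, vecShift, add_tsub_cancel_of_le hut.le]
    have hU' : U = (fun p : Set.Iic u → (Fin 4 → ℝ) => p ⟨u, Set.mem_Iic.2 le_rfl⟩) ∘
        vecPast brownianQuad u :=
      rfl
    rw [hξ', hU']
    exact h0.comp (measurable_pi_apply _) (measurable_pi_apply _)
  -- the indicator of the test set
  set g : (Fin 4 → ℝ) × (Fin 4 → ℝ) → ℝ := (noiseBox c a ρ).indicator fun _ => (1 : ℝ) with hg
  have hgm : Measurable g := measurable_const.indicator (measurableSet_noiseBox c a ρ)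
  have hgb : ∀ p, |g p| ≤ 1 := fun p => by
    rw [hg]
    by_cases hp : p ∈ noiseBox c a ρ <;> simp [hp]
  have hE : MeasurableSet {ω | (ξ ω, U ω) ∈ noiseBox c a ρ} :=
    (hξm.prodMk hUm) (measurableSet_noiseBox c a ρ)
  -- the probability as an integral, then integrate out `U` against its Gaussian law
  have hreal : wienerQuad.real {ω | (ξ ω, U ω) ∈ noiseBox c a ρ} = ∫ ω, g (ξ ω, U ω) ∂wienerQuad := by
    rw [← integral_indicator_one hE]
    congr 1
  have hfub := IsBrownianVec.integral_comp_eq_integral_integral_of_indepFun hξm hUm hind hgm hgb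
  have hlaw : wienerQuad.map U = gaussVec 4 u := hW.map_apply u
  -- the inner integral is a Gaussian box probability
  have hinner : ∀ e : Fin 4 → ℝ, ∫ b, g (e, b) ∂(wienerQuad.map U) ≤ Bd := by
    intro e
    rw [hlaw]
    have hsec : (fun b => g (e, b)) = {b : Fin 4 → ℝ | (e, b) ∈ noiseBox c a ρ}.indicator 1 := by
      funext b
      rw [hg]
      by_cases hb : (e, b) ∈ noiseBox c a ρ
      · rw [indicator_of_mem hb, indicator_of_mem (show b ∈ {b | (e, b) ∈ noiseBox c a ρ} from hb)]
        rfl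
      · rw [indicator_of_notMem hb,
          indicator_of_notMem (show b ∉ {b | (e, b) ∈ noiseBox c a ρ} from hb)]
    have hSm : MeasurableSet {b : Fin 4 → ℝ | (e, b) ∈ noiseBox c a ρ} :=
      measurable_prodMk_left (measurableSet_noiseBox c a ρ)
    rw [hsec, integral_indicator_one hSm, measureReal_def]
    refine ENNReal.toReal_le_of_le_ofReal hBd0 ?_
    rw [noiseBox_section hc1]
    exact gaussVec_box_le hu _ (div_nonneg hρ h1c.le)
  -- assemble
  rw [← ofReal_measureReal, hreal, hfub]
  refine ENNReal.ofReal_le_ofReal ?_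
  calc ∫ ω, (∫ b, g (ξ ω, b) ∂(wienerQuad.map U)) ∂wienerQuad
      ≤ ∫ _, Bd ∂wienerQuad := by
        refine integral_mono_of_nonneg (Eventually.of_forall fun ω => ?_) (integrable_const Bd)
          (Eventually.of_forall fun ω => hinner (ξ ω))
        refine integral_nonneg fun b => ?_
        rw [hg]
        by_cases hb : (ξ ω, b) ∈ noiseBox c a ρ <;> simp [hb]
    _ = Bd := by simp


/-- **Small-ball estimate for the bridge marginal**: for `0 < u < t` the position `X_u` of the
bridge of duration `t` from `x` to `y` lies within `ρ` of a fixed point `z` with probability at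
most `(2ρ/((1 − u/t)√(2πu)))³`. [folklore] -/
theorem measure_dist_bridgePath_le {t u : ℝ≥0} (hu : u ≠ 0) (hut : u < t) (x y z : E3) {ρ : ℝ}
    (hρ : 0 ≤ ρ) :
    wienerQuad {ω | dist (bridgePath t x y ω u) z ≤ ρ}
      ≤ ENNReal.ofReal ((2 * (ρ / (1 - (u : ℝ) / t)) / Real.sqrt (2 * π * u)) ^ 3) := by
  set c : ℝ := (u : ℝ) / t with hc
  set a : Fin 4 → ℝ := Fin.cases 0 (fun j => (z - x - c • (y - x)) j) with ha
  refine le_trans (measure_mono fun ω hω => ?_) (measure_noiseBox_le hu hut a hρ)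
  simp only [mem_setOf_eq] at hω ⊢
  intro i hi
  obtain ⟨j, rfl⟩ := Fin.exists_succ_eq.2 hi
  have hcoord : dist (bridgePath t x y ω u j) (z j) ≤ ρ := (PiLp.dist_apply_le _ _ j).trans hω
  rw [Real.dist_eq] at hcoord
  have hexp : bridgePath t x y ω u j - z j = ((1 - c) * brownianQuad u ω j.succ
      - c * (brownianQuad t ω j.succ - brownianQuad u ω j.succ)) - a j.succ := by
    simp only [bridgePath, ha, Fin.cases_succ, ← hc, PiLp.add_apply, PiLp.sub_apply,
      PiLp.smul_apply, smul_eq_mul, bm3_apply]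
    ring
  rwa [hexp] at hcoord

end BrownianBridgeToPoint3

end Literature.Probability.Process
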